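import Literature.MathematicalPhysics.QuantumFieldTheory.LatticeGaugeAsymptotics
import HarnessLib

/-!
# Chatterjee's `ℤ₂` Wilson-loop asymptotics: corner edges (the printed `ℓ₀`) and a source audit

Companion of `Literature/MathematicalPhysics/QuantumFieldTheory/LatticeGaugeAsymptotics.lean`
(constructive-qft.S18). That file vendors
`Literature.MathematicalPhysics.QuantumFieldTheory.chatterjee_z2_wilsonLoops`, attributed to
S. Chatterjee, *Wilson loops in Ising lattice gauge theory*, Comm. Math. Phys. 377 (2020)
307–340 (arXiv:1811.09770), Thm. 1.1. Reading the source against that transcription (literature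
audit, 2026-08-15) shows that the vendored statement is **stronger than what is printed** on two
independent counts. This file records the discrepancy, DEFINES the notion the printed statement
needs and the tree lacks (`numCornerEdges`, Chatterjee's corner-edge count `ℓ₀`, with its API),
and writes out the faithful statement (section "The theorem as printed" below) for re-vendoring.
It declares no new named fact (D-0026: the auditing seat was a proving seat) and leaves the old
declaration untouched.

## The two discrepancies

1. **Corner convention.** Chatterjee, §1.1: "an edge `e` in `γ` will be called a *corner edge*
   if there is some other edge `e' ∈ γ` such that `e` and `e'` share a common plaquette. For
   example, a rectangular loop with length and width greater than one has exactly eight corner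
   edges." His `ℓ₀` is the number of corner edges. The transcription uses
   `Literature.MathematicalPhysics.QuantumLattice.numCorners w`, the number of (cyclic) *direction
   changes* of the walk, with the justification "every corner edge is adjacent to a direction
   change … the two counts differ by a factor `≤ 2`". This is false: two *parallel* edges of `γ`
   at lattice distance `1` share a plaquette without any direction change. For the `R × 1`
   rectangle every edge is a corner edge (`ℓ₀ = ℓ = 2R + 2`; note the width condition in
   Chatterjee's own example) while `numCorners = 4`; there the printed bound
   `C₁ (e^{-2β} + √(ℓ₀/ℓ))^{C₂} ≥ C₁` is vacuous, whereas the transcribed bound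
   `C₁ (e^{-2β} + √(4/ℓ))^{C₂}` tends to `0` and pins `⟨W_γ⟩` to `exp (-2ℓ e^{-12β})`. The proof
   in print genuinely uses the corner-edge notion: the conditional independence of the spins on
   the non-corner edges (§7, proof of Lemma 7.1, step `W⁵ → W⁶`, and Lemma 7.2) requires that no
   two of them lie on a common plaquette.
2. **States.** Thm. 1.1 is about the free-boundary infinite-volume expectation
   `⟨W_γ⟩_β := lim_{N → ∞} ⟨W_γ⟩_{N,β}` on the cubes `B_N = [-N, N]⁴ ∩ ℤ⁴` (§1.1, display (1.4);
   existence for `β ≥ β₀` is Cor. 5.5, proved through the duality of §4 between free cubes and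
   zero-boundary dual cubes and the Dobrushin correlation decay of §5). The transcription
   quantifies over all infinite-volume limit points of the *torus* Wilson states
   (`infiniteVolumeLimitPoints z2Rep β`); the paper proves nothing about periodic boundary
   conditions (its §6–§7 work with subsequential limits `μ_β` of the free-cube measures and use
   Thm. 5.3, a free-cube statement), so the docstring's "his finite-volume bounds are uniform in
   the volume and the boundary condition" is not supported by the text.

Both strengthenings are plausible (for `e ∈ γ = ∂Q` the number `|P(e) ∩ Q|` is always odd, and
Griffiths–Ginibre monotonicity relates torus and free-box expectations of `W_γ`), but neither is
in print; by the Literature discipline ("never a fact stated stronger than its source") the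
faithful statement is written out separately below (not declared in this file).

## Content

* `SharePlaquette e e'`: two positively oriented edges of `ℤ^d` lie on a common plaquette
  (`Literature.MathematicalPhysics.QuantumLattice.plaquetteEdges`).
* `walkEdges w`: the finite set of (unoriented, i.e. positively oriented representatives of the)
  edges traversed by a lattice walk (`dartStep`).
* `cornerEdges w`, `numCornerEdges w`: Chatterjee's corner edges of a loop and their number
  `ℓ₀`; `numCornerEdges_le_length : ℓ₀ ≤ ℓ`.

## The theorem as printed (faithful statement, for re-vendoring)

Thm. 1.1 with Cor. 5.5, for self-avoiding loops (`SimpleGraph.Walk.IsCycle` in `zdGraph 4`;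
Chatterjee allows generalized loops = finite edge-disjoint unions of self-avoiding loops, of which
single loops are the basic case), in the free-boundary finite-volume theory of `Sweep1.lean`
(`zdExpect z2Rep β (box 4 N)`: Haar = uniform measure on `ℤ₂` on every edge, weight
`exp (-β ∑_{p ⊆ B_N} (1 - σ_p)) ∝ exp (β ∑_{p ∈ P_N} σ_p)` over the plaquettes with all four
corners in `B_N = box 4 N = {-N, …, N}⁴` — exactly Chatterjee's measure (1.2)–(1.3) on `Σ_N`; the
edges outside `B_N` are independent uniform spins and do not enter `W_γ` for `γ ⊆ B_N`). The
following elaborates against this file plus `import Literature.MathematicalPhysics.QuantumFieldTheory.Sweep1`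
(checked 2026-08-15) and is the statement to vendor, e.g. as
`chatterjee_z2_wilsonLoops_freeBoundary`, `[cite: arXiv181109770, Thm. 1.1 and Cor. 5.5]`:

```
def chatterjee_z2_wilsonLoops_freeBoundary : Prop :=
  ∃ β₀ C₁ C₂ : ℝ, 0 < C₁ ∧ 0 < C₂ ∧ ∀ β : ℝ, β₀ ≤ β →
    ∀ (x : Literature.Probability.LatticeModels.Site 4) (w : (zdGraph 4).Walk x x), w.IsCycle →
      ∃ W : ℝ,
        HasBoxLimit (fun Λ => zdExpect z2Rep β Λ (wilsonLoopObs z2Character w)) W ∧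
          |W - z2WilsonMainTerm β w.length| ≤
            C₁ * errorTerm β w.length (numCornerEdges w) ^ C₂
```

The rectangles-only transcription
`Literature.MathematicalPhysics.QuantumFieldTheory.chatterjee_isingGauge_wilsonLoop` (`Sweep1.lean`,
free-boundary box limits, `R, T ≥ 1`, with `√(8/ℓ)` on the grounds that "`ℓ₀ ∈ {4, 8}` for a
rectangle") is faithful for `R, T ≥ 2` but shares discrepancy 1 for rectangles of width `1`
(`min (R, T) = 1`), all of whose `2R + 2` edges are corner edges; the statement above covers all
self-avoiding loops with the printed `√(ℓ₀/ℓ)`.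

## References

* S. Chatterjee, *Wilson loops in Ising lattice gauge theory*, Comm. Math. Phys. 377 (2020)
  307–340, doi:10.1007/s00220-020-03738-9, arXiv:1811.09770: §1.1 (model, corner edges,
  Thm. 1.1), Cor. 5.5 (existence of the free-boundary limit), §7 (proof). [arXiv181109770]
-/

noncomputable section

open MeasureTheory Filter Topology SimpleGraph
open Literature.Probability.LatticeModels

namespace Literature.MathematicalPhysics.QuantumFieldTheory

open Literature.MathematicalPhysics.QuantumLattice (ZdPlaquette plaquetteEdges dartStep)

variable {d : ℕ}

/-! ### Corner edges of a lattice loop (Chatterjee's `ℓ₀`) -/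

/-- Two positively oriented edges `e, e'` of `ℤ^d` *share a plaquette*: both belong to the edge
set `plaquetteEdges p` of some plaquette `p` (Chatterjee, CMP 377 (2020) §1.1, "`e` and `e'`
share a common plaquette"). Besides perpendicular edges meeting at a vertex this includes pairs of
parallel edges at lattice distance `1`. [cite: arXiv181109770, §1.1] -/
def SharePlaquette (e e' : QuantumLattice.ZdEdge d) : Prop :=
  ∃ p : ZdPlaquette d, e ∈ plaquetteEdges p ∧ e' ∈ plaquetteEdges p

/-- Sharing a plaquette is a symmetric relation. [folklore] -/
theorem SharePlaquette.symm {e e' : QuantumLattice.ZdEdge d} (h : SharePlaquette e e') :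
    SharePlaquette e' e := by
  obtain ⟨p, he, he'⟩ := h
  exact ⟨p, he', he⟩

/-- The set of edges of `ℤ^d` traversed by a lattice walk `w` (each dart `x → y` contributes its
underlying positively oriented edge `(dartStep e).1`, cf.
`Literature.MathematicalPhysics.QuantumLattice.dartStep`); for a self-avoiding loop of length `ℓ`
this set has `ℓ` elements (Chatterjee, CMP 377 (2020) §1.1: "Let `γ` be a loop in `B_N`, with
edges `e₁, …, e_m`"). [cite: arXiv181109770, §1.1] -/
def walkEdges {x y : Literature.Probability.LatticeModels.Site d} (w : (zdGraph d).Walk x y) : Finset (QuantumLattice.ZdEdge d) :=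
  (w.darts.map fun e => (dartStep e).1).toFinset

/-- The number of distinct edges of a walk is at most its length. [folklore] -/
theorem card_walkEdges_le_length {x y : Literature.Probability.LatticeModels.Site d} (w : (zdGraph d).Walk x y) :
    (walkEdges w).card ≤ w.length := by
  unfold walkEdges
  refine (List.toFinset_card_le _).trans ?_
  rw [List.length_map, SimpleGraph.Walk.length_darts]

open Classical in
/-- Chatterjee's **corner edges** of a loop `γ`: the edges `e ∈ γ` for which some *other* edge
`e' ∈ γ` shares a plaquette with `e` (Chatterjee, CMP 377 (2020) §1.1: "an edge `e` in `γ` will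
be called a corner edge if there is some other edge `e' ∈ γ` such that `e` and `e'` share a common
plaquette. For example, a rectangular loop with length and width greater than one has exactly
eight corner edges"). For a rectangle of width `1` every edge is a corner edge. [cite: arXiv181109770, §1.1] -/
def cornerEdges {x y : Literature.Probability.LatticeModels.Site d} (w : (zdGraph d).Walk x y) : Finset (QuantumLattice.ZdEdge d) :=
  (walkEdges w).filter fun e => ∃ e' ∈ walkEdges w, e' ≠ e ∧ SharePlaquette e e'

/-- `ℓ₀`, the number of corner edges of the loop `γ` (Chatterjee, CMP 377 (2020) §1.1 and
Thm. 1.1). [cite: arXiv181109770, §1.1] -/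
def numCornerEdges {x y : Literature.Probability.LatticeModels.Site d} (w : (zdGraph d).Walk x y) : ℕ :=
  (cornerEdges w).card

/-- Membership in `cornerEdges`, unfolded. [folklore] -/
theorem mem_cornerEdges_iff {x y : Literature.Probability.LatticeModels.Site d} (w : (zdGraph d).Walk x y)
    (e : QuantumLattice.ZdEdge d) :
    e ∈ cornerEdges w ↔
      e ∈ walkEdges w ∧ ∃ e' ∈ walkEdges w, e' ≠ e ∧ SharePlaquette e e' := by
  unfold cornerEdges
  simp only [Finset.mem_filter]

/-- Corner edges are edges of the walk. [folklore] -/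
theorem cornerEdges_subset_walkEdges {x y : Literature.Probability.LatticeModels.Site d} (w : (zdGraph d).Walk x y) :
    cornerEdges w ⊆ walkEdges w :=
  fun e he => ((mem_cornerEdges_iff w e).1 he).1

/-- `ℓ₀ ≤ ℓ`: a loop has at most as many corner edges as edges (so `ℓ₀/ℓ ≤ 1` in Thm. 1.1).
[folklore] -/
theorem numCornerEdges_le_length {x y : Literature.Probability.LatticeModels.Site d} (w : (zdGraph d).Walk x y) :
    numCornerEdges w ≤ w.length :=
  (Finset.card_le_card (cornerEdges_subset_walkEdges w)).trans (card_walkEdges_le_length w)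

end Literature.MathematicalPhysics.QuantumFieldTheory
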